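import Mathlib
import HarnessLib
import Literature.Dynamics.TransferOperators.ChangMayerEigenfunction
import Literature.NumberTheory.DiophantineGeometry.NamedHypotheses
import Summits.RiemannHypothesis.RiemannHypothesis.Theses.MayerPairing
import Summits.RiemannHypothesis.RiemannHypothesis.Theorems.MayerPairingEigenvaluePredicate

/-!
# Line `frozen-eisenstein-rank-one` — skeleton for crux `MayerPairing.BranchPairing`

Crux item stmt-RiemannHypothesis-1471, route `route-RiemannHypothesis-MayerPairing`, idea card
`frozen-eisenstein-rank-one` (crux-ideate r1 k=2; triage r1: pass ×3, merged lever with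
`weinstein-aronszajn-pinning` / `frozen-eisenstein-pencil`).

LEVER. The rank-one "freezing" `L̃_s := L_s + κ(s)·|𝟙⟩⟨δ₀|`, `κ(s) = ζ(2s)/(2ζ(2s−1))`, of Mayer's
transfer operator has the Eisenstein vector `f_s = ψ(2s,·+1)` as an EXACT eigenvector with
eigenvalue `1` for every `0 < Re s < 1/2` (in-tree defect identity `mayerTransfer_zagierPsi_toFun`;
proved sorry-free by the triage panel, `PinnedEigenvector.lean` on the item). Sherman–Morrison turns
"`μ` is an eigenvalue of `L_s` near `1`" into the scalar SECULAR EQUATION `1 + κ(s)·G(s,μ) = 0`,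
`G(s,μ) = δ₀((μ − L̃_s)⁻¹𝟙)`, whose pole `μ = 1` is permanent and whose coupling `κ` vanishes
exactly at the zeros of `ζ(2s)` — i.e. at BOTH endpoints `ρ/2`, `(1−ρ̄)/2` of a BranchPairing segment.

LINE (height split at `2516`, the height of the tree's numerical-RH certificate; `T0 = 1258` in `s`).
* `stub_rhBelow`: zeros with `Im ρ ≤ 2516` are on the line — where BranchPairing is the dictionary
  (`exists_eigenfunction_of_riemannZeta_eq_zero`, in tree). The tree HAS `riemannHypothesisUpTo_2516`,
  but through `native_decide` (its axioms are outside the credit whitelist {propext, Classical.choice,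
  Quot.sound}, so it can close nothing); the stub asks for the KERNEL-checked certificate
  (`decide +kernel`, as `riemannHypothesisUpTo_hundredOne` does for height 101) — an engineering stub;
* above: `stub_highTame` (THE BET, RH-hard — the two tameness numbers of the frozen resolvent along the
  pairing segment of every off-line zero above 2516: a punctured disc of radius `ε' ≤ 1/2` about `1`
  inside the resolvent set of `L̃_s` with `(μ−1)G` bounded (gap + pole order ≤ 1), and the Rouché
  smallness `|κ G| < 1` on an inner circle; its all-heights proxy is shown to imply it
  (`highTame_of_allHeights`) and predicted false — see the stub's docstring: Jordan set `B₀`, hopping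
  bands)
  ⟹ `stub_secularRegular` (the Riemann extension `secularFx` of the secular function `(μ−1)(1+κG)`
  across the frozen pole is holomorphic in `μ` and jointly continuous in `(σ, μ)`) ⟹ `stub_zeroSelection`
  (Rouché + continuity of the simple zero: a continuous zero-selection `Λ` with `|Λ−1| < ε`) ⟹ the
  selected value is an eigenvalue of `L_s`: off the pole by `stub_secularRoot` (Sherman–Morrison), AT the
  pole with the coupling on by `stub_degenerateRoot` (Fredholm alternative / multiplicity count), and
  with the coupling off (`κ = 0 ⟺ ζ(2s) = 0`, in particular at both endpoints, where therefore `Λ = 1`)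
  by the dictionary.
* `BranchPairing_of : BranchPairing` is the kernel-checked composition (no sorry outside `stub_*`;
  axioms {propext, Classical.choice, Quot.sound} + sorryAx of the stubs), concluding the crux BY NAME
  through the in-tree predicate bridge `mayerPairing_branchPairing_iff_operator`.

Disproof.lean honoured: `ζ ρ = 0` is used at both ends (κ = 0 ⟺ ζ(2s) = 0; `not_withoutZero_of_ucc`,
`branchPairing_false_without_zero`); no global sheet (`not_eisensteinSheet`, `not_verticalPairing` are
LOW-height facts, τ ≤ 16; the bet starts at τ ≥ 1258); no mirror symmetry (§3) is used; continuity of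
`Λ` (the whole content, §2) comes from `stub_zeroSelection`.
-/

set_option linter.dupNamespace false

noncomputable section

namespace Summit.RiemannHypothesis.RiemannHypothesis.Cruxes.BranchPairing.FrozenEisensteinRankOne

open Filter Topology Metric Set Complex
open scoped ComplexConjugate
open Literature.Dynamics.TransferOperators
open Summit.RiemannHypothesis.RiemannHypothesis.Theses.MayerPairing

/-! ## Objects of the line -/

/-- The constant function `𝟙 ∈ B(D)`. -/
def oneB : MayerSpace :=
  MayerSpace.mk (fun _ => (1 : ℂ)) continuousOn_const (differentiableOn_const (1 : ℂ))

/-- Point evaluation `δ₀` at `0 ∈ D̄`. -/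
def ev0 : MayerSpace →L[ℂ] ℂ := MayerSpace.evalCLM ⟨0, zero_mem_mayerClosedDisc⟩

/-- The rank-one pin `K = |𝟙⟩⟨δ₀|`, `K g = g(0)·𝟙`. -/
def pinK : MayerSpace →L[ℂ] MayerSpace := ContinuousLinearMap.smulRight ev0 oneB

/-- The coupling `κ(s) = ζ(2s) / (2 ζ(2s−1))` (holomorphic on `0 < Re s < 1/2`, zero iff `ζ(2s) = 0`). -/
def kappa (s : ℂ) : ℂ := riemannZeta (2 * s) / (2 * riemannZeta (2 * s - 1))

/-- The FROZEN operator `L̃_s = L_s + κ(s) K` (Eisenstein eigenvalue identically `1`). -/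
def frozenTransfer (s : ℂ) : MayerSpace →L[ℂ] MayerSpace := mayerTransfer s + kappa s • pinK

/-- The pinned resolvent element `G(s,μ) = δ₀((μ − L̃_s)⁻¹ 𝟙)` (`Ring.inverse`: junk `0` off the
resolvent set). -/
def pinnedG (s μ : ℂ) : ℂ :=
  ev0 (Ring.inverse (μ • (1 : MayerSpace →L[ℂ] MayerSpace) - frozenTransfer s) oneB)

/-- The secular function `F_s(μ) = (μ − 1)(1 + κ(s) G(s,μ))` (meaningful off `μ = 1`; at `μ = 1` the
junk value of `Ring.inverse` makes it `0` — use `secularFx` there). -/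
def secularF (s μ : ℂ) : ℂ := (μ - 1) * (1 + kappa s * pinnedG s μ)

/-- The secular function with the frozen pole filled in by its punctured limit (Riemann extension;
`Function.update`/`limUnder` exactly as in Mathlib's removable-singularity API). Off `μ = 1` it IS
`secularF s μ` (`secularFx_of_ne_one`, `rfl`-level). -/
def secularFx (s μ : ℂ) : ℂ :=
  Function.update (secularF s) 1 (limUnder (𝓝[≠] (1 : ℂ)) (secularF s)) μ

/-- The parameter `s = σ + iτ`. -/
def sOf (σ τ : ℝ) : ℂ := (σ : ℂ) + (τ : ℂ) * Complex.I

/-! ## Registered stubs -/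

/-- STUB 1 (Sherman–Morrison / Weinstein–Aronszajn, rank-one): a root `μ` of the secular equation
`1 + κ(s) G(s,μ) = 0` in the resolvent set of the frozen operator is an eigenvalue of Mayer's `L_s`,
with eigenvector `g = (μ − L̃_s)⁻¹ 𝟙 ≠ 0`: `(μ − L_s) g = (μ − L̃_s) g + κ K g = (1 + κ G)·𝟙 = 0`.
Pure Banach-algebra identity (all `s`, `μ`). -/
theorem stub_secularRoot :
    ∀ s μ : ℂ, IsUnit (μ • (1 : MayerSpace →L[ℂ] MayerSpace) - frozenTransfer s) →
      1 + kappa s * pinnedG s μ = 0 →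
      ∃ g : MayerSpace, g ≠ 0 ∧ mayerTransfer s g = μ • g := by
  sorry

/-- STUB 2 (Rouché + continuity of the simple zero; pure complex analysis): a family `F σ` of
holomorphic functions on a disc about `1`, jointly continuous in `(σ, μ)`, each within `ε` of `μ − 1`
on the circle `‖μ − 1‖ = ε`, has exactly one zero in the open `ε`-disc, and that zero depends
continuously on `σ`. -/
theorem stub_zeroSelection :
    ∀ (F : ℝ → ℂ → ℂ) (a b ε ε' : ℝ), a ≤ b → 0 < ε → ε < ε' →
      ContinuousOn (fun p : ℝ × ℂ => F p.1 p.2) (Set.Icc a b ×ˢ Metric.ball (1 : ℂ) ε') →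
      (∀ σ ∈ Set.Icc a b, DifferentiableOn ℂ (F σ) (Metric.ball (1 : ℂ) ε')) →
      (∀ σ ∈ Set.Icc a b, ∀ μ : ℂ, ‖μ - 1‖ = ε → ‖F σ μ - (μ - 1)‖ < ε) →
      ∃ Λ : ℝ → ℂ, ContinuousOn Λ (Set.Icc a b) ∧
        ∀ σ ∈ Set.Icc a b, ‖Λ σ - 1‖ < ε ∧ F σ (Λ σ) = 0 ∧
          ∀ μ : ℂ, ‖μ - 1‖ < ε → F σ μ = 0 → μ = Λ σ := by
  sorry

/-- STUB 3 (regularity of the extended secular function; operator theory + Riemann): along a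
horizontal segment `σ ∈ [a,b] ⊂ (0, 1/2)` at height `τ > 0`, if the punctured disc `0 < ‖μ − 1‖ < ε'`
lies in the resolvent set of `L̃_{σ+iτ}` with `‖(μ − 1) G‖ ≤ M` there, then `secularFx` is holomorphic
in `μ` on the whole disc and jointly continuous in `(σ, μ)` (resolvent analyticity
`hasDerivAt_resolvent_const_left` (Mathlib GelfandFormula); continuity of `s ↦ L_s` from `MayerTransferHolomorphic_holds` and of
`κ`; `NormedRing.inverse_continuousAt`; `Complex.differentiableOn_update_limUnder_of_bddAbove`; maximum
principle on small circles for the joint continuity at `μ = 1`). -/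
theorem stub_secularRegular :
    ∀ (τ a b ε' M : ℝ), 0 < a → a ≤ b → b < 1 / 2 → 0 < τ → 0 < ε' →
      (∀ σ ∈ Set.Icc a b, ∀ μ : ℂ, 0 < ‖μ - 1‖ → ‖μ - 1‖ < ε' →
          IsUnit (μ • (1 : MayerSpace →L[ℂ] MayerSpace) - frozenTransfer (sOf σ τ)) ∧
            ‖(μ - 1) * pinnedG (sOf σ τ) μ‖ ≤ M) →
      ContinuousOn (fun p : ℝ × ℂ => secularFx (sOf p.1 τ) p.2)
          (Set.Icc a b ×ˢ Metric.ball (1 : ℂ) ε') ∧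
        ∀ σ ∈ Set.Icc a b, DifferentiableOn ℂ (secularFx (sOf σ τ)) (Metric.ball (1 : ℂ) ε') := by
  sorry

/-- STUB 4 — THE BET (hardest; RH-hard; the card's "HighPairing tameness", cut to exactly what
`BranchPairing` consumes): for every OFF-LINE zero `ρ` above the certified height `2516`, along its
pairing segment `σ ∈ [Re ρ/2, (1 − Re ρ)/2]` at height `τ = Im ρ/2`, the TWO tameness numbers of the
frozen resolvent are good, uniformly in `σ`:
(i) GAP / POLE ORDER: a punctured disc `0 < ‖μ − 1‖ < ε'` (`ε' ≤ 1/2`) about the frozen eigenvalue `1`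
lies in the resolvent set of `L̃_s` and `‖(μ − 1)·G(s,μ)‖ ≤ M` on it (no other pinned eigenvalue within
`ε'`; pole of `G` at `1` of order ≤ 1, i.e. `s` is not a Jordan point of the frozen eigenvalue);
(ii) ROUCHÉ SMALLNESS on an inner circle `‖μ − 1‖ = ε`: `‖κ(s)·G(s,μ)‖ < 1`
(≈ `|κ r|/ε + |κ|·sup|H| < 1`, with `|κ(σ+iτ)| ≪ τ^{σ−1+o(1)}` by convexity + the functional equation).
STATUS. Vacuous under RH (no such `ρ`), hence not refutable alone — exactly like the crux; it is the
crux's RH-hard content relocalised into resolvent bounds at hypothetical heights. Its ζ-free, TESTABLE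
strengthening (the same bounds at ALL heights `τ ≥ T`, `T ≤ 1258`, on all segments) implies it
(`highTame_of_allHeights`, proved below) but is PREDICTED FALSE by this seat: (i) fails near every point
of the Jordan set `B₀ = {s : ζ(2s) ≠ 0, δ₀((1 − L_s)⁻² 𝟙) = 0}` (where a second pinned eigenvalue passes
through `1`; `r(s)` has a pole there), `B₀` is the zero set of a transcendental holomorphic function
with no reason to be finite, and around each `s₀ ∈ B₀` the two exceptional points `s₀ ± O(|κ|^{1/2})` of
`L_s` bound a HOPPING BAND of heights in which the forced continuation of the Eisenstein eigenvalue
across `Re s = Re s₀` provably lands on the other sheet (2×2 Weinstein–Aronszajn model; the low-height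
instance is Disproof §2d `not_verticalPairing`). So the honest reading of this stub is: "off-line zero
heights avoid the hopping bands of `B₀` (and the coupling is small there)". Data (τ ≤ 20; j013263,
j013317, j013445): `|κ r| ≈ 0.1–0.5`, pinned gap `≥ 0.29`, `|κ|·sup|H| ≤ 3`; whole-line isolation false
at γ₁..γ₃ (so the all-heights form with `T = 7` is false); τ ~ 10³ is not computable with the
Taylor–Hurwitz matrix. -/
theorem stub_highTame :
    ∀ ρ : ℂ, riemannZeta ρ = 0 → 0 < ρ.re → ρ.re < 1 / 2 → 2516 < ρ.im →
      ∃ ε ε' M : ℝ, 0 < ε ∧ ε < ε' ∧ ε' ≤ 1 / 2 ∧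
        (∀ σ ∈ Set.Icc (ρ.re / 2) ((1 - ρ.re) / 2), ∀ μ : ℂ, 0 < ‖μ - 1‖ → ‖μ - 1‖ < ε' →
            IsUnit (μ • (1 : MayerSpace →L[ℂ] MayerSpace) - frozenTransfer (sOf σ (ρ.im / 2))) ∧
              ‖(μ - 1) * pinnedG (sOf σ (ρ.im / 2)) μ‖ ≤ M) ∧
        (∀ σ ∈ Set.Icc (ρ.re / 2) ((1 - ρ.re) / 2), ∀ μ : ℂ, ‖μ - 1‖ = ε →
            ‖kappa (sOf σ (ρ.im / 2)) * pinnedG (sOf σ (ρ.im / 2)) μ‖ < 1) := by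
  sorry

/-- TESTABLE PROXY of the bet (a proved transfer, NOT a stub; ζ enters only through `κ`): if the
tameness numbers (i), (ii) hold at EVERY height `τ ≥ T` (some `T ≤ 1258`) along EVERY segment
`[a,b] ⊂ (0, 1/2)`, then `stub_highTame` holds (specialise to `τ = Im ρ/2`, the pairing segment).
The all-heights hypothesis is PREDICTED FALSE for every `T` by this seat (Jordan set `B₀` of the frozen
eigenvalue non-empty above `T` ⇒ (i) fails near it — see `stub_highTame`); with `T = 7` it is
numerically false already (whole-line isolation fails at γ₁/2, γ₂/2, γ₃/2: j013317). CHEAPEST FALSIFIER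
at computable heights: locate the zeros of `s ↦ δ₀((1 − L_s)⁻² 𝟙) = (2/ζ(2s))·δ₀((1 − L_s)⁻¹ f_s)` in
`(0,1/2) × [7, 25]` (argument principle on rectangles; Taylor–Hurwitz matrix, N ≈ 2.3τ + 45) and their
count per unit height. -/
theorem highTame_of_allHeights (T : ℝ) (hT : T ≤ 1258)
    (h : ∀ τ : ℝ, T ≤ τ → ∀ a b : ℝ, 0 < a → a ≤ b → b < 1 / 2 →
      ∃ ε ε' M : ℝ, 0 < ε ∧ ε < ε' ∧ ε' ≤ 1 / 2 ∧
        (∀ σ ∈ Set.Icc a b, ∀ μ : ℂ, 0 < ‖μ - 1‖ → ‖μ - 1‖ < ε' →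
            IsUnit (μ • (1 : MayerSpace →L[ℂ] MayerSpace) - frozenTransfer (sOf σ τ)) ∧
              ‖(μ - 1) * pinnedG (sOf σ τ) μ‖ ≤ M) ∧
        (∀ σ ∈ Set.Icc a b, ∀ μ : ℂ, ‖μ - 1‖ = ε →
            ‖kappa (sOf σ τ) * pinnedG (sOf σ τ) μ‖ < 1)) :
    ∀ ρ : ℂ, riemannZeta ρ = 0 → 0 < ρ.re → ρ.re < 1 / 2 → 2516 < ρ.im →
      ∃ ε ε' M : ℝ, 0 < ε ∧ ε < ε' ∧ ε' ≤ 1 / 2 ∧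
        (∀ σ ∈ Set.Icc (ρ.re / 2) ((1 - ρ.re) / 2), ∀ μ : ℂ, 0 < ‖μ - 1‖ → ‖μ - 1‖ < ε' →
            IsUnit (μ • (1 : MayerSpace →L[ℂ] MayerSpace) - frozenTransfer (sOf σ (ρ.im / 2))) ∧
              ‖(μ - 1) * pinnedG (sOf σ (ρ.im / 2)) μ‖ ≤ M) ∧
        (∀ σ ∈ Set.Icc (ρ.re / 2) ((1 - ρ.re) / 2), ∀ μ : ℂ, ‖μ - 1‖ = ε →
            ‖kappa (sOf σ (ρ.im / 2)) * pinnedG (sOf σ (ρ.im / 2)) μ‖ < 1) := by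
  intro ρ _ h0 hlt hhigh
  exact h (ρ.im / 2) (by linarith) (ρ.re / 2) ((1 - ρ.re) / 2) (by linarith) (by linarith)
    (by linarith)

/-- STUB 5 (the degenerate root; Fredholm alternative / multiplicity count for the compact `L̃_s`):
if the coupling is ON (`κ(s) ≠ 0`), the frozen eigenvalue `1` is isolated with `(μ−1)G` bounded, and
nevertheless the secular function tends to `0` at the pole (residue `κ·r(s) = 0`), then `1` is STILL an
eigenvalue of `L_s`. Mechanism: `r = f_s(0)·ℓ̃_s(𝟙)/ℓ̃_s(f_s)` with `f_s(0) = ζ(2s−1) ≠ 0`, so `r = 0`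
(or a Jordan chain at `1`, via the boundedness of `(μ−1)G`) forces `ℓ̃_s(𝟙) = 0` for the left
eigenvector, i.e. `𝟙 ∈ Range(1 − L̃_s)` (Fredholm alternative), and then
`g = −κ g₀ + t f_s` (`(1 − L̃_s) g₀ = 𝟙`, `t` fixing `g(0) = 1`) solves `L_s g = g`; if `1` has
geometric multiplicity ≥ 2 for `L̃_s`, any frozen eigenvector vanishing at `0` already does.
(Equivalently: `ord₁ [det(μ − L_s)/det(μ − L̃_s)] = ord₁ (1 + κG) ≥ 0`.) With the converse Mayer–Efrat
dictionary this situation never occurs off the zeros — the stub is what lets the line NOT depend on it. -/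
theorem stub_degenerateRoot :
    ∀ s : ℂ, 0 < s.re → s.re < 1 / 2 → kappa s ≠ 0 →
      (∃ ε' M : ℝ, 0 < ε' ∧ ∀ μ : ℂ, 0 < ‖μ - 1‖ → ‖μ - 1‖ < ε' →
          IsUnit (μ • (1 : MayerSpace →L[ℂ] MayerSpace) - frozenTransfer s) ∧
            ‖(μ - 1) * pinnedG s μ‖ ≤ M) →
      Tendsto (fun μ : ℂ => secularF s μ) (𝓝[≠] (1 : ℂ)) (𝓝 0) →
      ∃ g : MayerSpace, g ≠ 0 ∧ mayerTransfer s g = g := by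
  sorry

/-- STUB 6 (numerical RH below the threshold, KERNEL-checked): every zero of `ζ` with
`0 < Im ρ ≤ 2516` has `Re ρ = 1/2`. TRUE — it is the in-tree
`Literature.NumberTheory.LFunctions.riemannHypothesisUpTo_2516` (Odlyzko–te Riele brackets of the first
2000 zeros + Backlund/Turing count) — but that proof runs on `native_decide`, whose auxiliary axioms are
outside the closing whitelist, so citing it closes nothing (`closed = false`). WANTED here: the same
certificate re-checked by the kernel (`decide +kernel` in chunks, exactly as
`RiemannHypothesisUpTo101.lean` does for 29 zeros), or any axiom-clean proof. Do NOT discharge this stub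
with `exact riemannHypothesisUpTo_2516`. -/
theorem stub_rhBelow : Literature.NumberTheory.DiophantineGeometry.RiemannHypothesisUpTo 2516 := by
  sorry

/-! ## Proved glue (bookkeeping; no sorry below this line) -/

theorem sOf_re (σ τ : ℝ) : (sOf σ τ).re = σ := by simp [sOf]

/-- `2·(Re ρ/2 + i Im ρ/2) = ρ`. -/
theorem two_mul_sOf_left (ρ : ℂ) : 2 * sOf (ρ.re / 2) (ρ.im / 2) = ρ := by
  apply Complex.ext
  · simp only [sOf, Complex.mul_re, Complex.add_re, Complex.ofReal_re, Complex.ofReal_im,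
      Complex.I_re, Complex.I_im, Complex.mul_im, Complex.add_im, Complex.re_ofNat,
      Complex.im_ofNat]
    ring
  · simp only [sOf, Complex.mul_re, Complex.add_re, Complex.ofReal_re, Complex.ofReal_im,
      Complex.I_re, Complex.I_im, Complex.mul_im, Complex.add_im, Complex.re_ofNat,
      Complex.im_ofNat]
    ring

/-- `2·((1 − Re ρ)/2 + i Im ρ/2) = 1 − conj ρ` (the mirror endpoint). -/
theorem two_mul_sOf_right (ρ : ℂ) : 2 * sOf ((1 - ρ.re) / 2) (ρ.im / 2) = 1 - conj ρ := by
  apply Complex.ext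
  · simp only [sOf, Complex.mul_re, Complex.add_re, Complex.ofReal_re, Complex.ofReal_im,
      Complex.I_re, Complex.I_im, Complex.mul_im, Complex.add_im, Complex.re_ofNat,
      Complex.im_ofNat, Complex.sub_re, Complex.one_re, Complex.conj_re]
    ring
  · simp only [sOf, Complex.mul_re, Complex.add_re, Complex.ofReal_re, Complex.ofReal_im,
      Complex.I_re, Complex.I_im, Complex.mul_im, Complex.add_im, Complex.re_ofNat,
      Complex.im_ofNat, Complex.sub_im, Complex.one_im, Complex.conj_im]
    ring

/-- The reflection of a zero in the critical line is a zero (Mathlib functional equation +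
conjugation symmetry). -/
theorem riemannZeta_one_sub_conj_eq_zero {ρ : ℂ} (hζ : riemannZeta ρ = 0) (h0 : 0 < ρ.re)
    (him : ρ.im ≠ 0) : riemannZeta (1 - conj ρ) = 0 := by
  have hconj : riemannZeta (conj ρ) = 0 := by rw [riemannZeta_conj, hζ, map_zero]
  have hn : ∀ n : ℕ, conj ρ ≠ -(n : ℂ) := by
    intro n h
    have := congrArg Complex.re h
    simp at this
    have : (0 : ℝ) ≤ n := n.cast_nonneg
    linarith
  have h1 : conj ρ ≠ 1 := by
    intro h
    have := congrArg Complex.im h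
    simp at this
    exact him this
  rw [riemannZeta_one_sub hn h1, hconj, mul_zero]

/-- `ζ(2s) = 0 ⇒ κ(s) = 0`. -/
theorem kappa_eq_zero_of_zeta {s : ℂ} (h : riemannZeta (2 * s) = 0) : kappa s = 0 := by
  simp [kappa, h]

/-- `κ(s) = 0 ⇒ ζ(2s) = 0` on the strip `0 < Re s < 1/2` (`ζ(2s − 1) ≠ 0` there). -/
theorem zeta_eq_zero_of_kappa {s : ℂ} (h0 : 0 < s.re) (h1 : s.re < 1 / 2) (hκ : kappa s = 0) :
    riemannZeta (2 * s) = 0 := by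
  unfold kappa at hκ
  rcases div_eq_zero_iff.1 hκ with h | h
  · exact h
  · exfalso
    have hne : riemannZeta (2 * s - 1) ≠ 0 :=
      riemannZeta_sub_one_ne_zero (σ := 2 * s) (by simp; linarith) (by simp; linarith)
    apply hne
    have h2 : (2 : ℂ) ≠ 0 := two_ne_zero
    exact (mul_eq_zero.1 h).resolve_left h2

/-- With the coupling off, the secular function is `μ − 1`. -/
theorem secularF_of_kappa_eq_zero {s : ℂ} (hκ : kappa s = 0) (μ : ℂ) : secularF s μ = μ - 1 := by
  simp [secularF, hκ]

/-- `F_s(μ) − (μ − 1) = (μ − 1)·κ(s)·G(s,μ)`. -/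
theorem secularF_sub (s μ : ℂ) : secularF s μ - (μ - 1) = (μ - 1) * (kappa s * pinnedG s μ) := by
  unfold secularF; ring

/-- Off the pole the extension is the secular function. -/
theorem secularFx_of_ne_one (s : ℂ) {μ : ℂ} (hμ : μ ≠ 1) : secularFx s μ = secularF s μ := by
  simp [secularFx, Function.update_of_ne hμ]

/-- A function holomorphic on the disc and equal to `F_s` off the centre has `F_s → g 1` at the
pole. -/
theorem tendsto_secularF_of_extension {g : ℂ → ℂ} {s : ℂ} {ε' : ℝ} (hε' : 0 < ε')
    (hg : DifferentiableOn ℂ g (Metric.ball (1 : ℂ) ε'))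
    (heq : ∀ μ ∈ Metric.ball (1 : ℂ) ε', μ ≠ 1 → g μ = secularF s μ) :
    Tendsto (fun μ : ℂ => secularF s μ) (𝓝[≠] (1 : ℂ)) (𝓝 (g 1)) := by
  have hca : ContinuousAt g 1 :=
    (hg.differentiableAt (Metric.isOpen_ball.mem_nhds (Metric.mem_ball_self hε'))).continuousAt
  have h1 : Tendsto g (𝓝[≠] (1 : ℂ)) (𝓝 (g 1)) := tendsto_nhdsWithin_of_tendsto_nhds hca.tendsto
  refine h1.congr' ?_
  have hball : Metric.ball (1 : ℂ) ε' ∈ 𝓝[≠] (1 : ℂ) :=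
    mem_nhdsWithin_of_mem_nhds (Metric.ball_mem_nhds 1 hε')
  filter_upwards [hball, self_mem_nhdsWithin] with μ hμ hne
  exact heq μ hμ hne

/-- A function holomorphic on the disc and equal to `μ − 1` off the centre vanishes at the centre. -/
theorem extension_eq_zero_of_kappa_eq_zero {g : ℂ → ℂ} {s : ℂ} {ε' : ℝ} (hε' : 0 < ε')
    (hg : DifferentiableOn ℂ g (Metric.ball (1 : ℂ) ε'))
    (heq : ∀ μ ∈ Metric.ball (1 : ℂ) ε', μ ≠ 1 → g μ = secularF s μ) (hκ : kappa s = 0) :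
    g 1 = 0 := by
  have h1 := tendsto_secularF_of_extension hε' hg heq
  have h2 : Tendsto (fun μ : ℂ => secularF s μ) (𝓝[≠] (1 : ℂ)) (𝓝 0) := by
    have : (fun μ : ℂ => secularF s μ) = fun μ => μ - 1 := by
      funext μ; exact secularF_of_kappa_eq_zero hκ μ
    rw [this]
    have hc : Continuous fun μ : ℂ => μ - 1 := by fun_prop
    have := (hc.tendsto (1 : ℂ))
    simp only [sub_self] at this
    exact tendsto_nhdsWithin_of_tendsto_nhds this
  exact tendsto_nhds_unique h1 h2

/-! ## The composition: the stubs imply the crux, by name -/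

/-- **Skeleton theorem.** `stub_secularRoot`, `stub_degenerateRoot`, `stub_zeroSelection`,
`stub_secularRegular`, `stub_highTame` and `stub_rhBelow` imply `BranchPairing` (via the in-tree
predicate bridge `mayerPairing_branchPairing_iff_operator`, the Chang–Mayer dictionary
`exists_eigenfunction_of_riemannZeta_eq_zero` and Mathlib's functional equation). Logical shape:
`stub_rhBelow → stub_highTame → stub_secularRegular → stub_zeroSelection → (stub_secularRoot ∧
stub_degenerateRoot) → BranchPairing`. No `sorry` outside the stubs. -/
theorem BranchPairing_of : BranchPairing := by
  rw [Summit.RiemannHypothesis.RiemannHypothesis.Theorems.mayerPairing_branchPairing_iff_operator]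
  intro ρ hζ h0 hle h14
  -- the dictionary at a parameter `s` with `ζ(2s) = 0`, `0 < Re s < 1/2`
  have dict : ∀ s : ℂ, 0 < s.re → s.re < 1 / 2 → riemannZeta (2 * s) = 0 →
      (1 : ℂ) ≠ 0 ∧ ∃ g : MayerSpace, g ≠ 0 ∧ mayerTransfer s g = (1 : ℂ) • g := by
    intro s hs0 hs1 hs
    obtain ⟨f, hf0, hf1, -⟩ := exists_eigenfunction_of_riemannZeta_eq_zero hs0 hs1 hs
    exact ⟨one_ne_zero, f, hf0, by rw [hf1, one_smul]⟩
  rcases eq_or_lt_of_le hle with hline | hlt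
  · -- ON-LINE zero: the segment is the point `σ = 1/4`, the selection is the constant `1`
    refine ⟨fun _ => 1, continuousOn_const, rfl, rfl, ?_⟩
    intro σ hσ
    obtain ⟨hσ1, hσ2⟩ := hσ
    have hσeq : σ = ρ.re / 2 := by rw [hline] at hσ1 hσ2 ⊢; linarith
    have hpar : 2 * sOf σ (ρ.im / 2) = ρ := by rw [hσeq]; exact two_mul_sOf_left ρ
    have key := dict (sOf σ (ρ.im / 2)) (by rw [sOf_re]; linarith) (by rw [sOf_re]; linarith)
      (by rw [hpar]; exact hζ)
    exact key
  · -- OFF-LINE zero: above the certified height, the perturbative mechanism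
    have hhigh : (2516 : ℝ) < ρ.im := by
      by_contra hcon
      push Not at hcon
      have := stub_rhBelow ρ hζ (by linarith) hcon
      linarith
    -- the bet: tameness of the frozen resolvent along this zero's segment
    obtain ⟨ε, ε', M, hε, hεε', hε'half, hres, hsmall⟩ := stub_highTame ρ hζ h0 hlt hhigh
    have hε' : 0 < ε' := lt_trans hε hεε'
    set τ : ℝ := ρ.im / 2 with hτdef
    set a : ℝ := ρ.re / 2 with hadef
    set b : ℝ := (1 - ρ.re) / 2 with hbdef
    have hτ0 : 0 < τ := by rw [hτdef]; linarith
    have ha0 : 0 < a := by rw [hadef]; linarith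
    have hab : a ≤ b := by rw [hadef, hbdef]; linarith
    have hb : b < 1 / 2 := by rw [hbdef]; linarith
    -- the regular extension of the secular function
    set Fx : ℝ → ℂ → ℂ := fun σ μ => secularFx (sOf σ τ) μ with hFxdef
    obtain ⟨hFcont, hFdiff⟩ := stub_secularRegular τ a b ε' M ha0 hab hb hτ0 hε' hres
    have hFeq : ∀ σ ∈ Set.Icc a b, ∀ μ ∈ Metric.ball (1 : ℂ) ε', μ ≠ 1 →
        Fx σ μ = secularF (sOf σ τ) μ := by
      intro σ _ μ _ hμ
      exact secularFx_of_ne_one _ hμ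
    -- the Rouché inequality for the extension on the inner circle
    have hrouche : ∀ σ ∈ Set.Icc a b, ∀ μ : ℂ, ‖μ - 1‖ = ε → ‖Fx σ μ - (μ - 1)‖ < ε := by
      intro σ hσ μ hμ
      have hμ1 : μ ≠ 1 := by
        intro h; rw [h, sub_self, norm_zero] at hμ; exact hε.ne hμ
      have hμball : μ ∈ Metric.ball (1 : ℂ) ε' := by
        rw [Metric.mem_ball, dist_eq_norm, hμ]; exact hεε'
      rw [hFeq σ hσ μ hμball hμ1, secularF_sub, norm_mul, hμ]
      have := hsmall σ hσ μ hμ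
      calc ε * ‖kappa (sOf σ τ) * pinnedG (sOf σ τ) μ‖ < ε * 1 :=
            mul_lt_mul_of_pos_left this hε
        _ = ε := mul_one ε
    -- the continuous zero selection
    obtain ⟨Λ, hΛcont, hΛ⟩ :=
      stub_zeroSelection Fx a b ε ε' hab hε hεε' hFcont (fun σ hσ => hFdiff σ hσ) hrouche
    -- parameters on the segment
    have hseg : ∀ σ ∈ Set.Icc a b, 0 < (sOf σ τ).re ∧ (sOf σ τ).re < 1 / 2 := by
      intro σ hσ; obtain ⟨h1, h2⟩ := hσ; rw [sOf_re]; constructor <;> linarith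
    -- where the coupling is off, the selection is exactly 1
    have hone : ∀ σ ∈ Set.Icc a b, kappa (sOf σ τ) = 0 → Λ σ = 1 := by
      intro σ hσ hκ
      obtain ⟨-, -, huniq⟩ := hΛ σ hσ
      have h1 : Fx σ 1 = 0 :=
        extension_eq_zero_of_kappa_eq_zero hε' (hFdiff σ hσ) (hFeq σ hσ) hκ
      exact (huniq 1 (by rw [sub_self, norm_zero]; exact hε) h1).symm
    refine ⟨Λ, hΛcont, ?_, ?_, ?_⟩
    · -- left endpoint `s = ρ/2`: `ζ(2s) = ζ ρ = 0`
      have hmem : a ∈ Set.Icc a b := ⟨le_rfl, hab⟩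
      apply hone a hmem
      apply kappa_eq_zero_of_zeta
      rw [hadef, hτdef, two_mul_sOf_left]; exact hζ
    · -- right endpoint `s = (1 − conj ρ)/2`: `ζ(2s) = ζ(1 − conj ρ) = 0` (functional equation)
      have hmem : b ∈ Set.Icc a b := ⟨hab, le_rfl⟩
      apply hone b hmem
      apply kappa_eq_zero_of_zeta
      rw [hbdef, hτdef, two_mul_sOf_right]
      exact riemannZeta_one_sub_conj_eq_zero hζ h0 (by linarith)
    · -- every selected value is a nonzero eigenvalue of `L_s`
      intro σ hσ
      obtain ⟨hnear, hzero, huniq⟩ := hΛ σ hσ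
      obtain ⟨hs0, hs1⟩ := hseg σ hσ
      have hΛne0 : Λ σ ≠ 0 := by
        intro h
        rw [h, zero_sub, norm_neg, norm_one] at hnear
        linarith
      refine ⟨hΛne0, ?_⟩
      by_cases hκ : kappa (sOf σ τ) = 0
      · -- coupling off: `Λ σ = 1` and the dictionary
        have h1 : Λ σ = 1 := hone σ hσ hκ
        have hz : riemannZeta (2 * sOf σ τ) = 0 := zeta_eq_zero_of_kappa hs0 hs1 hκ
        obtain ⟨-, g, hg, hLg⟩ := dict (sOf σ τ) hs0 hs1 hz
        refine ⟨g, hg, ?_⟩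
        rw [h1]
        exact hLg
      · by_cases hΛ1 : Λ σ = 1
        · -- coupling on but the root sits AT the pole: the degenerate root is still an eigenvalue
          have ht := tendsto_secularF_of_extension hε' (hFdiff σ hσ) (hFeq σ hσ)
          have h0 : secularFx (sOf σ τ) 1 = 0 := by simpa [hFxdef, hΛ1] using hzero
          rw [h0] at ht
          have hdata : ∃ ε'' M' : ℝ, 0 < ε'' ∧ ∀ μ : ℂ, 0 < ‖μ - 1‖ → ‖μ - 1‖ < ε'' →
              IsUnit (μ • (1 : MayerSpace →L[ℂ] MayerSpace) - frozenTransfer (sOf σ τ)) ∧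
                ‖(μ - 1) * pinnedG (sOf σ τ) μ‖ ≤ M' :=
            ⟨ε', M, hε', fun μ h1 h2 => hres σ hσ μ h1 h2⟩
          obtain ⟨g, hg, hLg⟩ := stub_degenerateRoot (sOf σ τ) hs0 hs1 hκ hdata ht
          refine ⟨g, hg, ?_⟩
          rw [hΛ1, one_smul]
          exact hLg
        · -- coupling on, root off the pole: Sherman–Morrison
          have hpos : 0 < ‖Λ σ - 1‖ := norm_pos_iff.2 (sub_ne_zero.2 hΛ1)
          have hball : Λ σ ∈ Metric.ball (1 : ℂ) ε' := by
            rw [Metric.mem_ball, dist_eq_norm]; exact lt_trans hnear hεε'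
          obtain ⟨hunit, -⟩ := hres σ hσ (Λ σ) hpos (lt_trans hnear hεε')
          have hF : secularF (sOf σ τ) (Λ σ) = 0 := by
            rw [← hFeq σ hσ (Λ σ) hball hΛ1]; exact hzero
          have hroot : 1 + kappa (sOf σ τ) * pinnedG (sOf σ τ) (Λ σ) = 0 := by
            unfold secularF at hF
            exact (mul_eq_zero.1 hF).resolve_left (sub_ne_zero.2 hΛ1)
          exact stub_secularRoot (sOf σ τ) (Λ σ) hunit hroot

end Summit.RiemannHypothesis.RiemannHypothesis.Cruxes.BranchPairing.FrozenEisensteinRankOne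

end
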